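import Summits.MatrixMultiplication.OmegaCensus.SmallFormats.MatMul228GF3NoK123
import HarnessLib

/-!
# ω-census family (a): **K1, K2, K3 DEFLATE** — an all-ones `(8,27)` marginal alive ⇒ an explicit 24-term `𝔽₃`-scheme for `⟨2,2,7⟩` (the dichotomy closed, unconditionally)

Cell `pub-omega` (unit `pub-omega-tensor`, gen 42), topic `Summits/MatrixMultiplication/OmegaCensus` (sub-folder `SmallFormats`). Framing (verbatim): lottery
ticket; floor = certified bounds/negative ranges. HONEST FRAMING: the unconditional content of the `NoK123` chain (p760544 … `NoK123`), in the shape of the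
`K827Deflation` words for K4, K9, K10 (p752621/p753019/p753037): IF `Cover827.REP827 j` (`j < 3`: K1, K2, K3) is the X-marginal of a 27-term `𝔽₃`-computation `β`
of `⟨2,2,8⟩`, THEN there is a 24-term `𝔽₃`-computation of `⟨2,2,7⟩` whose X-marginal is `REP827 j` restricted along an injection `Fin 24 → Fin 27` (so it misses
exactly three terms — an L-shape `{(v, μ), (v, j₄), (v₄, μ)}` of cells). PROOF: the structure package (`K123Structure.structure_package`); EITHER some (row pair, column
pair) is admissible — then the deflation dichotomy conjunct gives the scheme (`AdmissiblePairKill.exists_deflation`) — OR none is, i.e. the obstruction normal form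
holds, and then the `NoM1`-type argument (obstruction combinatorics, `K123Certificates.certificates_valid`, `K123Entries`, Sylvester `≥ 7` against Brent `≤ 6`) is a
contradiction. `K827Deflation.exists_comp227_of_xMarginal_eq_K123`; the conditional word `NoK123.xMarginal_ne_K123_of_tensorRank_227_eq` is its corollary
(re-derived here as `xMarginal_ne_K123_of_no_comp24`: any proof that NO 24-term scheme for `⟨2,2,7⟩` has one of these deflate marginals excludes K1–K3). K1–K3 are
NOT excluded unconditionally here. Nothing on `ω`.
-/

namespace Summit.MatrixMultiplication.OmegaCensus.SmallFormats

open Finset Module Matrix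
open Literature.Computability.AlgebraicComplexity
open Summit.MatrixMultiplication.OmegaCensus.RankOnePlaneCapGeneral

namespace K827Deflation

/-- **K1/K2/K3 deflate.** If `REP827 j` (`j < 3`) is the X-marginal of a 27-term `𝔽₃`-computation of `⟨2,2,8⟩`, then some 24-term `𝔽₃`-computation of
`⟨2,2,7⟩` has X-marginal `REP827 j ∘ e` for an injection `e : Fin 24 → Fin 27`. -/
theorem exists_comp227_of_xMarginal_eq_K123 (j : ℕ) (hj : j < 3) (β : BilinComp (mulBilin (ZMod 3) 2 2 8) (Fin 27))
    (hM : xMarginal β = Cover827.REP827 j) :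
    ∃ (β' : BilinComp (mulBilin (ZMod 3) 2 2 7) (Fin 24)) (e : Fin 24 → Fin 27), Function.Injective e ∧ ∀ x, xMarginal β' x = Cover827.REP827 j (e x) := by
  classical
  obtain ⟨c, b, L, L', hci, hbi, hcch, hbch, hcr, hbr, hL1, hL2, hL'1, hL'2, hL3, hL4, hL5, hL'4, hL'5, hL6, hL'6, hdefl⟩ :=
    K123Structure.structure_package j hj β hM
  by_cases hadm : ∃ v μ a bb a' bb', a ≠ bb ∧ L v a = L v bb ∧ μ ≠ a ∧ μ ≠ bb ∧ a' ≠ bb' ∧ L' μ a' = L' μ bb' ∧ L' μ v ≠ L' μ a'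
  · obtain ⟨v, μ, a, bb, a', bb', h1, h2, h3, h4, h5, h6, h7⟩ := hadm
    obtain ⟨-, -, -, -, -, -, -, -, β', e, he, -, hxm⟩ := hdefl v μ a bb a' bb' h1 h2 h3 h4 h5 h6 h7
    exact ⟨β', e, he, hxm⟩
  exfalso
  have hNF : ∀ v μ a bb a' bb', a ≠ bb → L v a = L v bb → μ ≠ a → μ ≠ bb → a' ≠ bb' → L' μ a' = L' μ bb' → L' μ v ≠ L' μ a' → False :=
    fun v μ a bb a' bb' h1 h2 h3 h4 h5 h6 h7 => hadm ⟨v, μ, a, bb, a', bb', h1, h2, h3, h4, h5, h6, h7⟩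
  -- combinatorics of the normal form
  have hNF' : ∀ v μ a bb a' bb', a ≠ bb → L v a = L v bb → μ ≠ a → μ ≠ bb → a' ≠ bb' → L' μ a' = L' μ bb' → L' μ v = L' μ a' :=
    fun v μ a bb a' bb' h1 h2 h3 h4 h5 h6 => by by_contra h; exact hNF v μ a bb a' bb' h1 h2 h3 h4 h5 h6 h
  have hRni : ∀ v, ∃ a bb : Fin 4, a ≠ bb ∧ L v a = L v bb := fun v => by
    obtain ⟨a, bb, h, hne⟩ := Function.not_injective_iff.mp (hL4 v); exact ⟨a, bb, hne, h⟩
  have hCni : ∀ μ, ∃ a bb : Fin 4, a ≠ bb ∧ L' μ a = L' μ bb := fun μ => by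
    obtain ⟨a, bb, h, hne⟩ := Function.not_injective_iff.mp (hL'4 μ); exact ⟨a, bb, hne, h⟩
  have hR22 : ∀ v a bb cc dd, a ≠ bb → a ≠ cc → a ≠ dd → bb ≠ cc → bb ≠ dd → cc ≠ dd → ¬ (L v a = L v bb ∧ L v cc = L v dd) :=
    fun v a bb cc dd h1 h2 h3 h4 h5 h6 h => ObstructionComb.no_two_two_row L L' hRni hCni hL'5 hNF' v a bb cc dd h1 h2 h3 h4 h5 h6 h.1 h.2
  have hC22 : ∀ μ a bb cc dd, a ≠ bb → a ≠ cc → a ≠ dd → bb ≠ cc → bb ≠ dd → cc ≠ dd → ¬ (L' μ a = L' μ bb ∧ L' μ cc = L' μ dd) :=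
    fun μ a bb cc dd h1 h2 h3 h4 h5 h6 h => ObstructionComb.no_two_two_col L L' hRni hCni hL5 hL'5 hNF' μ a bb cc dd h1 h2 h3 h4 h5 h6 h.1 h.2
  have hcomp : ∀ v μ, (∃ j, j ≠ μ ∧ L v j = L v μ) ↔ ¬ (∃ i, i ≠ v ∧ L' μ i = L' μ v) :=
    fun v μ => ObstructionComp.row_iff_not_col L L' hRni hCni hL5 hL'5 hR22 hC22 hNF' v μ
  -- pair codes of the rows
  have hcode : ∀ v, ∃ k : Fin 6, ∀ μ, (∃ j, j ≠ μ ∧ L v j = L v μ) ↔ μ ∈ (![{0, 1}, {0, 2}, {0, 3}, {1, 2}, {1, 3}, {2, 3}] : Fin 6 → Finset (Fin 4)) k := by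
    intro v
    obtain ⟨k, hk⟩ := NoM1.exists_code _ (ObstructionComp.card_hasP_eq_two (L v) (hRni v) (hL5 v) (hR22 v))
    refine ⟨k, fun μ => ?_⟩
    rw [← hk, Finset.mem_filter]
    simp
  choose pc hpc using hcode
  have hcol2 : ∀ μ : Fin 4, (Finset.univ.filter fun v : Fin 4 => μ ∈ (![{0, 1}, {0, 2}, {0, 3}, {1, 2}, {1, 3}, {2, 3}] : Fin 6 → Finset (Fin 4)) (pc v)).card = 2 := by
    intro μ
    have h1 : (Finset.univ.filter fun v : Fin 4 => μ ∈ (![{0, 1}, {0, 2}, {0, 3}, {1, 2}, {1, 3}, {2, 3}] : Fin 6 → Finset (Fin 4)) (pc v)) =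
        Finset.univ.filter fun v => ¬ ∃ i, i ≠ v ∧ L' μ i = L' μ v := by
      ext v; simp only [Finset.mem_filter, Finset.mem_univ, true_and]; rw [← hpc v μ]; exact hcomp v μ
    have h2 := ObstructionComp.card_hasP_eq_two (L' μ) (hCni μ) (hL'5 μ) (hC22 μ)
    have h3 := Finset.card_filter_add_card_filter_not (s := (Finset.univ : Finset (Fin 4))) (fun v => ∃ i, i ≠ v ∧ L' μ i = L' μ v)
    rw [h1]
    rw [Finset.card_univ, Fintype.card_fin, h2] at h3
    omega
  have hcolpair : ∀ μ v, μ ∈ (![{0, 1}, {0, 2}, {0, 3}, {1, 2}, {1, 3}, {2, 3}] : Fin 6 → Finset (Fin 4)) (pc v) → ∃ w, w ≠ v ∧ μ ∈ (![{0, 1}, {0, 2}, {0, 3}, {1, 2}, {1, 3}, {2, 3}] : Fin 6 → Finset (Fin 4)) (pc w) := by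
    intro μ v hv
    obtain ⟨x, y, hxy, hs⟩ := Finset.card_eq_two.mp (hcol2 μ)
    have hvin : v ∈ ({x, y} : Finset (Fin 4)) := by rw [← hs, Finset.mem_filter]; exact ⟨Finset.mem_univ _, hv⟩
    have hxin : x ∈ Finset.univ.filter fun v : Fin 4 => μ ∈ (![{0, 1}, {0, 2}, {0, 3}, {1, 2}, {1, 3}, {2, 3}] : Fin 6 → Finset (Fin 4)) (pc v) := by rw [hs]; simp
    have hyin : y ∈ Finset.univ.filter fun v : Fin 4 => μ ∈ (![{0, 1}, {0, 2}, {0, 3}, {1, 2}, {1, 3}, {2, 3}] : Fin 6 → Finset (Fin 4)) (pc v) := by rw [hs]; simp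
    rw [Finset.mem_filter] at hxin hyin
    rcases Finset.mem_insert.mp hvin with rfl | hv'
    · exact ⟨y, hxy.symm, hyin.2⟩
    · rw [Finset.mem_singleton] at hv'; subst hv'; exact ⟨x, hxy, hxin.2⟩
  have hrownon : ∀ v μ, ¬ μ ∈ (![{0, 1}, {0, 2}, {0, 3}, {1, 2}, {1, 3}, {2, 3}] : Fin 6 → Finset (Fin 4)) (pc v) → ∃ m, m ≠ μ ∧ ¬ m ∈ (![{0, 1}, {0, 2}, {0, 3}, {1, 2}, {1, 3}, {2, 3}] : Fin 6 → Finset (Fin 4)) (pc v) := by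
    intro v μ hμ
    have hc : (Finset.univ.filter fun m : Fin 4 => ¬ m ∈ (![{0, 1}, {0, 2}, {0, 3}, {1, 2}, {1, 3}, {2, 3}] : Fin 6 → Finset (Fin 4)) (pc v)).card = 2 := by
      have key : ∀ k : Fin 6, (Finset.univ.filter fun m : Fin 4 => ¬ m ∈ (![{0, 1}, {0, 2}, {0, 3}, {1, 2}, {1, 3}, {2, 3}] : Fin 6 → Finset (Fin 4)) k).card = 2 := by decide
      exact key (pc v)
    obtain ⟨x, y, hxy, hs⟩ := Finset.card_eq_two.mp hc
    have hμin : μ ∈ ({x, y} : Finset (Fin 4)) := by rw [← hs, Finset.mem_filter]; exact ⟨Finset.mem_univ _, hμ⟩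
    have hxin : x ∈ Finset.univ.filter fun m : Fin 4 => ¬ m ∈ (![{0, 1}, {0, 2}, {0, 3}, {1, 2}, {1, 3}, {2, 3}] : Fin 6 → Finset (Fin 4)) (pc v) := by rw [hs]; simp
    have hyin : y ∈ Finset.univ.filter fun m : Fin 4 => ¬ m ∈ (![{0, 1}, {0, 2}, {0, 3}, {1, 2}, {1, 3}, {2, 3}] : Fin 6 → Finset (Fin 4)) (pc v) := by rw [hs]; simp
    rw [Finset.mem_filter] at hxin hyin
    rcases Finset.mem_insert.mp hμin with rfl | hμ'
    · exact ⟨y, hxy.symm, hyin.2⟩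
    · rw [Finset.mem_singleton] at hμ'; subst hμ'; exact ⟨x, hxy, hxin.2⟩
  -- the certificate
  have hpv : (![pc 0, pc 1, pc 2, pc 3] : Fin 4 → Fin 6) = pc := by
    funext v; fin_cases v <;> rfl
  obtain ⟨hXY, hheavy, hact12, hact, -, hdist', hdiag, hlower⟩ :=
    K123Certificates.certificates_valid j hj (pc 0) (pc 1) (pc 2) (pc 3) (by rw [hpv]; exact hcol2)
  rw [hpv] at hdiag hlower
  set X₀ := (K123Defs.certTable ⟨j, hj⟩ (pc 0) (pc 1) (pc 2)).1 with hX₀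
  set Y := (K123Defs.certTable ⟨j, hj⟩ (pc 0) (pc 1) (pc 2)).2.1 with hY
  set sc := (K123Defs.certTable ⟨j, hj⟩ (pc 0) (pc 1) (pc 2)).2.2.1 with hsc
  set tc := (K123Defs.certTable ⟨j, hj⟩ (pc 0) (pc 1) (pc 2)).2.2.2 with htc
  have hXunit : IsUnit X₀.det := Matrix.isUnit_det_of_right_inverse hXY
  have hYinv : X₀⁻¹ = Y := Matrix.inv_eq_right_inv hXY
  -- the value of an X-form at X₀
  have hfval : ∀ x : Fin 4 × Fin 4, β.f ((![![16, 15, 18, 17], ![12, 11, 14, 13], ![24, 23, 26, 25], ![20, 19, 22, 21]] : Fin 4 → Fin 4 → Fin 27) x.1 x.2) X₀ = ∑ r, ∑ s', (Cover827.REP827 j) ((![![16, 15, 18, 17], ![12, 11, 14, 13], ![24, 23, 26, 25], ![20, 19, 22, 21]] : Fin 4 → Fin 4 → Fin 27) x.1 x.2) r s' * X₀ r s' := by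
    intro x
    rw [f_apply_eq_sum_xMarginal, hM]
    exact Finset.sum_congr rfl fun r _ => Finset.sum_congr rfl fun s' _ => mul_comm _ _
  -- the entries of the minor
  have hRm : ∀ v μ, μ ∈ (![{0, 1}, {0, 2}, {0, 3}, {1, 2}, {1, 3}, {2, 3}] : Fin 6 → Finset (Fin 4)) (pc v) ↔ ∃ j, j ≠ μ ∧ L v j = L v μ := fun v μ => (hpc v μ).symm
  have hzero : ∀ i j : Fin 3, j < i →
      (∑ p, ∑ q, Y q p * (β.w ((![![16, 15, 18, 17], ![12, 11, 14, 13], ![24, 23, 26, 25], ![20, 19, 22, 21]] : Fin 4 → Fin 4 → Fin 27) (sc i).1 (sc i).2) p ⬝ᵥ (fun jj => β.g ((![![16, 15, 18, 17], ![12, 11, 14, 13], ![24, 23, 26, 25], ![20, 19, 22, 21]] : Fin 4 → Fin 4 → Fin 27) (tc j).1 (tc j).2) (Matrix.single q jj (1 : ZMod 3))))) = 0 :=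
    fun i j hij => K123Entries.Q_eq_zero_of_pred β c b L L' hci hbi hcch hbch hcr hbr hL1 hL2 hL'1 hL'2 hL3 hRni hCni hL5 hL'5 hR22 hC22 hL6 hL'6
      (fun v μ => μ ∈ (![{0, 1}, {0, 2}, {0, 3}, {1, 2}, {1, 3}, {2, 3}] : Fin 6 → Finset (Fin 4)) (pc v)) hRm hcomp Y (sc i) (tc j) (hlower i j hij) hcolpair hrownon
  have hne : ∀ i : Fin 3,
      (∑ p, ∑ q, Y q p * (β.w ((![![16, 15, 18, 17], ![12, 11, 14, 13], ![24, 23, 26, 25], ![20, 19, 22, 21]] : Fin 4 → Fin 4 → Fin 27) (sc i).1 (sc i).2) p ⬝ᵥ (fun jj => β.g ((![![16, 15, 18, 17], ![12, 11, 14, 13], ![24, 23, 26, 25], ![20, 19, 22, 21]] : Fin 4 → Fin 4 → Fin 27) (tc i).1 (tc i).2) (Matrix.single q jj (1 : ZMod 3))))) ≠ 0 :=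
    fun i => K123Entries.Q_ne_zero_of_pred β c b L L' hci hbi hcch hbch hcr hbr hL1 hL2 hL'1 hL'2 hL3 hRni hCni hL5 hL'5 hR22 hC22 hL6 hL'6
      (fun v μ => μ ∈ (![{0, 1}, {0, 2}, {0, 3}, {1, 2}, {1, 3}, {2, 3}] : Fin 6 → Finset (Fin 4)) (pc v)) hRm hcomp Y (sc i) (tc i) (hdiag i) hcolpair hrownon
  -- Sylvester's lower bound
  set ACT : Finset (Fin 4 × Fin 4) := Finset.univ.filter fun x : Fin 4 × Fin 4 =>
    (∑ r, ∑ s', (Cover827.REP827 j) ((![![16, 15, 18, 17], ![12, 11, 14, 13], ![24, 23, 26, 25], ![20, 19, 22, 21]] : Fin 4 → Fin 4 → Fin 27) x.1 x.2) r s' * X₀ r s') ≠ 0 with hACT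
  have hT := BrentAtPoint.isUnit_det_pointMatrix (n := 8) X₀ hXunit
  have hTinv : (Matrix.of fun (a : Fin 2 × Fin 8) (b' : Fin 2 × Fin 8) => X₀ b'.1 a.1 * (if a.2 = b'.2 then (1 : ZMod 3) else 0))⁻¹ =
      (Matrix.of fun (a : Fin 2 × Fin 8) (b' : Fin 2 × Fin 8) => Y b'.1 a.1 * (if a.2 = b'.2 then (1 : ZMod 3) else 0)) := by
    rw [← hYinv]; exact Matrix.inv_eq_right_inv (BrentAtPoint.pointMatrix_mul_inv X₀ hXunit)
  have hmemA : ∀ i, sc i ∈ ACT ∧ tc i ∈ ACT := fun i => by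
    rw [hACT, Finset.mem_filter, Finset.mem_filter]; exact ⟨⟨Finset.mem_univ _, (hact i).1⟩, ⟨Finset.mem_univ _, (hact i).2⟩⟩
  have hS := SylvesterRank.card_add_le_rank_sub_sum (p := ACT) (Matrix.of fun (a : Fin 2 × Fin 8) (b' : Fin 2 × Fin 8) => X₀ b'.1 a.1 * (if a.2 = b'.2 then (1 : ZMod 3) else 0)) hT
    (fun x a => β.g ((![![16, 15, 18, 17], ![12, 11, 14, 13], ![24, 23, 26, 25], ![20, 19, 22, 21]] : Fin 4 → Fin 4 → Fin 27) x.1.1 x.1.2) (Matrix.single a.1 a.2 (1 : ZMod 3))) (fun x a => β.w ((![![16, 15, 18, 17], ![12, 11, 14, 13], ![24, 23, 26, 25], ![20, 19, 22, 21]] : Fin 4 → Fin 4 → Fin 27) x.1.1 x.1.2) a.1 a.2)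
    (fun x => β.f ((![![16, 15, 18, 17], ![12, 11, 14, 13], ![24, 23, 26, 25], ![20, 19, 22, 21]] : Fin 4 → Fin 4 → Fin 27) x.1.1 x.1.2) X₀)
    (fun x => by rw [hfval]; exact (Finset.mem_filter.mp x.2).2)
    (fun i => ⟨sc i, (hmemA i).1⟩) (fun j => ⟨tc j, (hmemA j).2⟩) (fun i j h => hdist' i j (congrArg Subtype.val h))
    (by
      have hentry : ∀ i j : Fin 3, (fun a : Fin 2 × Fin 8 => β.w ((![![16, 15, 18, 17], ![12, 11, 14, 13], ![24, 23, 26, 25], ![20, 19, 22, 21]] : Fin 4 → Fin 4 → Fin 27) (sc i).1 (sc i).2) a.1 a.2) ⬝ᵥ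
          ((Matrix.of fun (a : Fin 2 × Fin 8) (b' : Fin 2 × Fin 8) => X₀ b'.1 a.1 * (if a.2 = b'.2 then (1 : ZMod 3) else 0))⁻¹.mulVec (fun a : Fin 2 × Fin 8 => β.g ((![![16, 15, 18, 17], ![12, 11, 14, 13], ![24, 23, 26, 25], ![20, 19, 22, 21]] : Fin 4 → Fin 4 → Fin 27) (tc j).1 (tc j).2) (Matrix.single a.1 a.2 (1 : ZMod 3)))) =
          ∑ p, ∑ q, Y q p * (β.w ((![![16, 15, 18, 17], ![12, 11, 14, 13], ![24, 23, 26, 25], ![20, 19, 22, 21]] : Fin 4 → Fin 4 → Fin 27) (sc i).1 (sc i).2) p ⬝ᵥ (fun jj => β.g ((![![16, 15, 18, 17], ![12, 11, 14, 13], ![24, 23, 26, 25], ![20, 19, 22, 21]] : Fin 4 → Fin 4 → Fin 27) (tc j).1 (tc j).2) (Matrix.single q jj (1 : ZMod 3)))) := by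
        intro i j
        rw [hTinv]
        exact PointPairing.vecW_dot_pointMatrix_vecG Y (β.w ((![![16, 15, 18, 17], ![12, 11, 14, 13], ![24, 23, 26, 25], ![20, 19, 22, 21]] : Fin 4 → Fin 4 → Fin 27) (sc i).1 (sc i).2))
          (Matrix.of fun q jj => β.g ((![![16, 15, 18, 17], ![12, 11, 14, 13], ![24, 23, 26, 25], ![20, 19, 22, 21]] : Fin 4 → Fin 4 → Fin 27) (tc j).1 (tc j).2) (Matrix.single q jj (1 : ZMod 3)))
      refine NoM1.det_ne_zero_of_triangular _ (fun i j hij => ?_) (fun i => ?_)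
      · rw [Matrix.of_apply, hentry]; exact hzero i j hij
      · rw [Matrix.of_apply, hentry]; exact hne i)
  -- Brent's upper bound
  have hB := BrentAtPoint.rank_sub_sum_le β X₀ (ACT.image fun x : Fin 4 × Fin 4 => (![![16, 15, 18, 17], ![12, 11, 14, 13], ![24, 23, 26, 25], ![20, 19, 22, 21]] : Fin 4 → Fin 4 → Fin 27) x.1 x.2)
  have hsum : ∑ t ∈ ACT.image (fun x : Fin 4 × Fin 4 => (![![16, 15, 18, 17], ![12, 11, 14, 13], ![24, 23, 26, 25], ![20, 19, 22, 21]] : Fin 4 → Fin 4 → Fin 27) x.1 x.2), β.f t X₀ •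
        Matrix.vecMulVec (fun a : Fin 2 × Fin 8 => β.g t (Matrix.single a.1 a.2 (1 : ZMod 3))) (fun b' : Fin 2 × Fin 8 => β.w t b'.1 b'.2) =
      ∑ x : ACT, β.f ((![![16, 15, 18, 17], ![12, 11, 14, 13], ![24, 23, 26, 25], ![20, 19, 22, 21]] : Fin 4 → Fin 4 → Fin 27) x.1.1 x.1.2) X₀ •
        Matrix.vecMulVec (fun a : Fin 2 × Fin 8 => β.g ((![![16, 15, 18, 17], ![12, 11, 14, 13], ![24, 23, 26, 25], ![20, 19, 22, 21]] : Fin 4 → Fin 4 → Fin 27) x.1.1 x.1.2) (Matrix.single a.1 a.2 (1 : ZMod 3)))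
          (fun b' : Fin 2 × Fin 8 => β.w ((![![16, 15, 18, 17], ![12, 11, 14, 13], ![24, 23, 26, 25], ![20, 19, 22, 21]] : Fin 4 → Fin 4 → Fin 27) x.1.1 x.1.2) b'.1 b'.2) := by
    rw [Finset.sum_image fun x _ y _ h => NoK123.cell_injective h, ← Finset.sum_coe_sort]
  rw [hsum] at hB
  have hB2 := le_trans hB (le_trans (Finset.card_le_card fun t ht => by
    simp only [Finset.mem_filter, Finset.mem_sdiff, Finset.mem_image, Finset.mem_univ, true_and] at ht
    obtain ⟨hnot, hf⟩ := ht
    rw [Finset.mem_filter]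
    have hf' : (∑ r, ∑ s', (Cover827.REP827 j) t r s' * X₀ r s') ≠ 0 := by
      rw [f_apply_eq_sum_xMarginal, hM] at hf
      have hc : (∑ c', ∑ d, X₀ c' d * (Cover827.REP827 j) t c' d) =
          ∑ r, ∑ s', (Cover827.REP827 j) t r s' * X₀ r s' := Finset.sum_congr rfl fun r _ => Finset.sum_congr rfl fun s' _ => mul_comm _ _
      rw [hc] at hf; exact hf
    refine ⟨Finset.mem_univ _, fun v μ h => ?_, hf'⟩
    apply hnot
    refine ⟨(v, μ), ?_, h⟩
    rw [hACT, Finset.mem_filter]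
    refine ⟨Finset.mem_univ _, ?_⟩
    show (∑ r, ∑ s', (Cover827.REP827 j) ((![![16, 15, 18, 17], ![12, 11, 14, 13], ![24, 23, 26, 25], ![20, 19, 22, 21]] : Fin 4 → Fin 4 → Fin 27) v μ) r s' * X₀ r s') ≠ 0
    rw [h]; exact hf') hheavy)
  have hcardA : Fintype.card ACT ≤ 12 := by rw [Fintype.card_coe]; exact hact12
  have hm : Fintype.card (Fin 2 × Fin 8) = 16 := by simp
  omega


/-- **Corollary (the shape a (7,24) census can discharge):** if no 24-term `𝔽₃`-computation of `⟨2,2,7⟩` has X-marginal `REP827 j ∘ e` for an injection `e`,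
then `REP827 j` (`j < 3`) is not the X-marginal of any 27-term computation of `⟨2,2,8⟩`. -/
theorem xMarginal_ne_K123_of_no_comp24 (j : ℕ) (hj : j < 3)
    (hno : ∀ (β' : BilinComp (mulBilin (ZMod 3) 2 2 7) (Fin 24)) (e : Fin 24 → Fin 27), Function.Injective e → xMarginal β' ≠ Cover827.REP827 j ∘ e)
    (β : BilinComp (mulBilin (ZMod 3) 2 2 8) (Fin 27)) : xMarginal β ≠ Cover827.REP827 j := by
  intro hM
  obtain ⟨β', e, he, hxm⟩ := exists_comp227_of_xMarginal_eq_K123 j hj β hM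
  exact hno β' e he (funext hxm)

end K827Deflation

end Summit.MatrixMultiplication.OmegaCensus.SmallFormats
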